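import Summits.Ventures.HodgeRepro2.T5InertIwasawaPrimitive
import Summits.Ventures.HodgeRepro2.T5InertSphericalEigenvalue
import Summits.Ventures.HodgeRepro2.T5LocalFieldUnitsDecomposition

/-!
# The Iwasawa decomposition `U(2,1) = N {a_m} K` at an inert place
(cell pub-hodge-repro2, seat p3)

Tier-5 N3 support — the hypothesis `hIw` of the Macdonald–Satake identification (files 216–217), now a theorem.
By file 219 every `g ∈ U(J₃(u))` has a `K`-translate `g κ` with bottom row `(0, 0, r)`; p8's `row_relations`
then force `g κ = diag(a, e, r) · n(b/a, c/a)` with `a r̄ = 1`, `e ē = 1` (`eq_diagonalUnit_mul_upper3`); `e` is a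
unit of `R` (`ValuationRing` + `hstar`); `a = a₀ ϖ^m` with `a₀ ∈ Rˣ` (p4's `exists_unit_mul_zpow`), so
`diag(a, e, r) = a_m · diag(a₀, e, ā₀⁻¹)` with the second factor in `K`; conjugating the unipotent part across
the diagonal factor and across `a_m` (diagonal conjugation preserves `N`) gives
**`exists_mem_mul_cellZ_mul : ∀ g, ∃ n ∈ N, ∃ m : ℤ, ∃ κ ∈ K, g = n a_m κ`**. Hence the Macdonald–Satake
identification of file 217 holds UNCONDITIONALLY (**`heckeSMul_cellU_one_eq_smul_param'`**): the spherical vector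
`f₀` of the unramified principal series `I(χ_α)` satisfies `T₁ f₀ = (q²(α + α⁻¹) + (q − 1)) f₀`.

Mathlib + this seat's files 219 / 217 + p4's T5LocalFieldUnitsDecomposition and their imports; no display; no device.
§8(d): uses an L-value-free non-vanishing device: NO.
-/

namespace Summit.Ventures.HodgeRepro2.T5InertIwasawa

open Matrix
open Summit.Ventures.HodgeRepro2.T5CartanCellsDistinct Summit.Ventures.HodgeRepro2.T5HermitianThreeElements
  Summit.Ventures.HodgeRepro2.T5UnitaryGroupForm Summit.Ventures.HodgeRepro2.T5UnitaryHeckeAdjoint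
  Summit.Ventures.HodgeRepro2.T5UnitaryThreeCorner Summit.Ventures.HodgeRepro2.T5CartanUniformiser
  Summit.Ventures.HodgeRepro2.T5InertUnipotentRadical Summit.Ventures.HodgeRepro2.T5InertIwasawaCosets
  Summit.Ventures.HodgeRepro2.T5InertIwasawaPrimitive Summit.Ventures.HodgeRepro2.T5HeckePermutationModule
  Summit.Ventures.HodgeRepro2.T5HeckeDoubleCoset Summit.Ventures.HodgeRepro2.T5HeckeBasisCells
  Summit.Ventures.HodgeRepro2.T5InertUnipotentResidue Summit.Ventures.HodgeRepro2.T5InertResidueInvolution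
  Summit.Ventures.HodgeRepro2.T5InertPrincipalSeries Summit.Ventures.HodgeRepro2.T5InertSphericalEigenvalue

/-! ## A unitary matrix with bottom row `(0, 0, r)` -/

section Upper

variable {E : Type*} [Field E] [StarRing E] (u : E) (hsu : star u = u) (hu0 : u ≠ 0)

include hsu hu0 in
/-- **`g ∈ U(J₃(u))` with bottom row `(0, 0, r)` is `diag(a, e, r) · n(b/a, c/a)`**, with `a r̄ = 1`, `e ē = 1`. -/
theorem eq_diagonalUnit_mul_upper3 (g : GL (Fin 3) E) (hg' : g ∈ formUnitaryGroup (J3 u)) (a b c d e f r : E)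
    (hg : (g : Matrix (Fin 3) (Fin 3) E) = !![a, b, c; d, e, f; 0, 0, r]) :
    a * star r = 1 ∧ e * star e = 1 ∧ ∃ (ha : a ≠ 0) (he : e ≠ 0) (hr : r ≠ 0),
      g = diagonalUnit ![Units.mk0 a ha, Units.mk0 e he, Units.mk0 r hr] * upper3 u (b / a) (c / a) := by
  obtain ⟨-, h2, h3, -, h5, h6, -, -, -⟩ := row_relations u hu0 g a b c d e f 0 0 r hg hg'
  simp only [star_zero, mul_zero, add_zero, zero_add] at h3 h6
  have hsr : star r ≠ 0 := fun h => by rw [h, mul_zero] at h3; exact zero_ne_one h3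
  have hd : d = 0 := (mul_eq_zero.1 h6).resolve_right hsr
  subst hd
  simp only [star_zero, mul_zero, zero_mul, add_zero, zero_add] at h2 h5
  have ha : a ≠ 0 := fun h => by rw [h, zero_mul] at h3; exact zero_ne_one h3
  have hr : r ≠ 0 := fun h => hsr (by rw [h, star_zero])
  have hee : e * star e = 1 := by
    have := h5
    field_simp at this
    linear_combination this
  have he : e ≠ 0 := fun h => by rw [h, zero_mul] at hee; exact zero_ne_one hee
  have hsa : star a ≠ 0 := star_ne_zero.2 ha
  -- `f = −b̄ e / (u ā)`
  have hf : f = -(star b * e) / (u * star a) := by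
    have h2' : star f = -(b * u⁻¹ * star e) / a := by
      rw [eq_div_iff ha]; linear_combination h2
    have := congrArg star h2'
    rw [star_star] at this
    rw [this]
    simp only [star_div₀, star_neg, star_mul, star_star, star_inv₀, hsu]
    field_simp
    try ring
  refine ⟨h3, hee, ha, he, hr, ?_⟩
  ext1
  rw [Units.val_mul, coe_diagonalUnit_fin_three, coe_upper3, Matrix.mul_fin_three, hg, fin_three_eq_iff]
  simp only [Units.val_mk0]
  refine ⟨by ring, by field_simp; try ring, by field_simp; try ring, by ring, by ring, ?_, by ring, by ring,
    by ring⟩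
  rw [hf, star_div₀]
  field_simp
  try ring

end Upper

/-! ## Units and the valuation -/

section Units

variable {R E : Type*} [CommRing R] [IsDomain R] [IsDiscreteValuationRing R] [Field E] [StarRing E]
  [Algebra R E] [IsFractionRing R E]
  (hstar : ∀ x : E, IsLocalization.IsInteger R x → IsLocalization.IsInteger R (star x))

include hstar in
/-- An element with `e ē = 1` is a unit of `R` (the valuation ring property of the DVR and `hstar`). -/
theorem isInteger_and_inv_of_mul_star_eq_one {e : E} (he : e * star e = 1) :
    IsLocalization.IsInteger R e ∧ IsLocalization.IsInteger R e⁻¹ := by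
  have he0 : e ≠ 0 := fun h => by rw [h, zero_mul] at he; exact zero_ne_one he
  have hinv : e⁻¹ = star e := (eq_inv_of_mul_eq_one_right he).symm
  rcases ValuationRing.isInteger_or_isInteger R e with h | h
  · exact ⟨h, by rw [hinv]; exact hstar _ h⟩
  · have : IsLocalization.IsInteger R e := by
      have := hstar _ h
      rwa [hinv, star_star] at this
    exact ⟨this, h⟩

end Units

/-! ## Conjugating a unipotent element by a diagonal unitary -/

section Conj

variable {E : Type*} [Field E] [StarRing E] (u : E)

omit [StarRing E] in
/-- `(fun i => (![α, β, γ] i)⁻¹) = ![α⁻¹, β⁻¹, γ⁻¹]`. -/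
theorem inv_vec_three (α β γ : Eˣ) : (fun i => (![α, β, γ] i)⁻¹) = ![α⁻¹, β⁻¹, γ⁻¹] := by
  funext i
  fin_cases i <;> rfl

/-- **Diagonal conjugation preserves `N`**: `diag(α, β, γ) n(x, z) diag(α, β, γ)⁻¹ = n(α x β⁻¹, α z γ⁻¹)` when
`ᾱ γ = 1` and `β̄ β = 1`. -/
theorem diagonalUnit_mul_upper3_mul_inv (α β γ : Eˣ) (hαγ : star (α : E) * γ = 1) (hβ : star (β : E) * β = 1)
    (x z : E) :
    diagonalUnit ![α, β, γ] * upper3 u x z * (diagonalUnit ![α, β, γ])⁻¹ =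
      upper3 u ((α : E) * x * (β : E)⁻¹) ((α : E) * z * (γ : E)⁻¹) := by
  have hγ : (γ : E) = (star (α : E))⁻¹ := eq_inv_of_mul_eq_one_right hαγ
  have hβ' : star (β : E) = (β : E)⁻¹ := eq_inv_of_mul_eq_one_left hβ
  have hα0 : (α : E) ≠ 0 := α.ne_zero
  have hβ0 : (β : E) ≠ 0 := β.ne_zero
  have hsα : star (α : E) ≠ 0 := star_ne_zero.2 hα0
  ext1
  rw [Units.val_mul, Units.val_mul, diagonalUnit_inv, inv_vec_three, coe_diagonalUnit_fin_three,
    coe_diagonalUnit_fin_three, coe_upper3, coe_upper3, Matrix.mul_fin_three, Matrix.mul_fin_three,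
    fin_three_eq_iff]
  simp only [Units.val_inv_eq_inv_val]
  refine ⟨by field_simp; try ring, by ring, by ring, by ring, by field_simp; try ring, ?_, by ring, by ring, ?_⟩
  · rw [star_mul, star_mul, star_inv₀, hβ', inv_inv, hγ, inv_inv]
    field_simp
    try ring
  · rw [hγ, inv_inv]
    field_simp
    try ring

end Conj

/-! ## The Iwasawa decomposition -/

section Main

variable {R E : Type*} [CommRing R] [IsDomain R] [IsDiscreteValuationRing R] [Field E] [StarRing E]
  [Algebra R E] [IsFractionRing R E]
  (hstar : ∀ x : E, IsLocalization.IsInteger R x → IsLocalization.IsInteger R (star x))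
  (u : E) (hsu : star u = u) (hu0 : u ≠ 0) (hu : IsLocalization.IsInteger R u)
  (hu' : IsLocalization.IsInteger R u⁻¹) {ϖ : R} (hϖ : Irreducible ϖ)
  (hs : star (algebraMap R E ϖ) = algebraMap R E ϖ)

include hstar hsu hu0 hu hu' in
/-- **THE IWASAWA DECOMPOSITION `U(J₃(u)) = N {a_m} K`**: every `g` is `n a_m κ` with `n ∈ N`, `m ∈ ℤ`, `κ ∈ K`. -/
theorem exists_mem_mul_cellZ_mul (g : formUnitaryGroup (J3 u)) :
    ∃ n ∈ upperUnipotent u, ∃ m : ℤ, ∃ κ ∈ hyperspecialSubgroup R (J3 u), g = n * cellZ u hϖ hs m * κ := by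
  obtain ⟨κ₁, hκ₁, a, b, c, d, e, f, r, hr0, hprod⟩ :=
    exists_mem_hyperspecial_coe_mul_eq hstar u hsu hu0 hu hu' hϖ g
  obtain ⟨har, hee, ha, he, hr, hg'⟩ :=
    eq_diagonalUnit_mul_upper3 u hsu hu0 ((g * κ₁ : formUnitaryGroup (J3 u)) : GL (Fin 3) E) (g * κ₁).2
      a b c d e f r hprod
  obtain ⟨heI, heI'⟩ := isInteger_and_inv_of_mul_star_eq_one hstar hee
  obtain ⟨a₀, m, ha₀⟩ := T5LocalFieldUnitsDecomposition.exists_unit_mul_zpow ϖ hϖ a ha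
  have hϖ0 : algebraMap R E ϖ ≠ 0 := (map_ne_zero_iff _ (IsFractionRing.injective R E)).2 hϖ.ne_zero
  -- the units `α = a₀`, `β = e`, `γ = ā₀⁻¹`
  set α : Eˣ := Units.map (algebraMap R E).toMonoidHom a₀ with hα
  have hαv : (α : E) = algebraMap R E (a₀ : R) := rfl
  have hα0 : (α : E) ≠ 0 := α.ne_zero
  set γ : Eˣ := (Units.map (starRingEnd E).toMonoidHom α)⁻¹ with hγ
  have hγv : (γ : E) = (star (α : E))⁻¹ := by
    rw [hγ, Units.val_inv_eq_inv_val, Units.coe_map]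
    rfl
  have hαγ : star (α : E) * γ = 1 := by rw [hγv, mul_inv_cancel₀ (star_ne_zero.2 hα0)]
  have hβ : star ((Units.mk0 e he : Eˣ) : E) * (Units.mk0 e he : Eˣ) = 1 := by
    rw [Units.val_mk0, mul_comm]; exact hee
  -- `t₀ = diag(a₀, e, ā₀⁻¹) ∈ K`
  let t₀ : formUnitaryGroup (J3 u) := ⟨diagonalUnit ![α, Units.mk0 e he, γ], diagonalUnit_mem u hαγ hβ⟩
  have ht₀K : t₀ ∈ hyperspecialSubgroup R (J3 u) := by
    rw [mem_hyperspecialSubgroup_iff]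
    refine diagonalUnit_mem_range ⟨a₀, hαv.symm⟩ ⟨((a₀⁻¹ : Rˣ) : R), ?_⟩ heI ?_ ?_ ?_
    · rw [Units.val_inv_eq_inv_val, hαv, map_units_inv]
    · rw [Units.val_inv_eq_inv_val, Units.val_mk0]; exact heI'
    · rw [hγv, ← star_inv₀]; exact hstar _ ⟨((a₀⁻¹ : Rˣ) : R), by rw [hαv, map_units_inv]⟩
    · rw [Units.val_inv_eq_inv_val, hγv, inv_inv]; exact hstar _ ⟨a₀, hαv.symm⟩
  -- `t = diag(a, e, r) = a_m t₀`
  have hr_eq : r = (star a)⁻¹ := by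
    have := eq_inv_of_mul_eq_one_right har
    rw [← star_star r, this, star_inv₀]
  have ht : (diagonalUnit ![Units.mk0 a ha, Units.mk0 e he, Units.mk0 r hr] : GL (Fin 3) E) =
      ((cellZ u hϖ hs m : formUnitaryGroup (J3 u)) : GL (Fin 3) E) * diagonalUnit ![α, Units.mk0 e he, γ] := by
    ext1
    rw [Units.val_mul, coe_cellZ, coe_diagonalUnit_fin_three, coe_diagonalUnit_fin_three, Matrix.mul_fin_three,
      fin_three_eq_iff]
    simp only [Units.val_mk0]
    refine ⟨?_, by ring, by ring, by ring, by ring, by ring, by ring, by ring, ?_⟩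
    · rw [ha₀, hαv]; ring
    · rw [hr_eq, ha₀, star_mul, star_zpow₀, hs, hγv, hαv, mul_inv, _root_.zpow_neg]; ring
  -- the unipotent part `n₁ = t⁻¹ (g κ₁) ∈ N`
  let tG : formUnitaryGroup (J3 u) := ⟨diagonalUnit ![Units.mk0 a ha, Units.mk0 e he, Units.mk0 r hr],
    diagonalUnit_mem u (by rw [Units.val_mk0, Units.val_mk0, ← star_star r, ← star_mul, mul_comm, har, star_one])
      hβ⟩
  have htG : tG = cellZ u hϖ hs m * t₀ := Subtype.ext ht
  let n₁ : formUnitaryGroup (J3 u) := tG⁻¹ * (g * κ₁)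
  have hn₁ : n₁ ∈ upperUnipotent u := by
    refine ⟨b / a, c / a, ?_⟩
    show ((tG⁻¹ * (g * κ₁) : formUnitaryGroup (J3 u)) : GL (Fin 3) E) = _
    rw [Subgroup.coe_mul, Subgroup.coe_inv, hg']
    exact inv_mul_cancel_left _ _
  have hgκ : g * κ₁ = cellZ u hϖ hs m * t₀ * n₁ := by
    simp only [n₁, ← htG, mul_inv_cancel_left]
  -- conjugate the unipotent part across `t₀` and across `a_m`
  have hn₂ : t₀ * n₁ * t₀⁻¹ ∈ upperUnipotent u := by
    obtain ⟨x, z, hx⟩ := hn₁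
    refine ⟨(α : E) * x * ((Units.mk0 e he : Eˣ) : E)⁻¹, (α : E) * z * (γ : E)⁻¹, ?_⟩
    rw [Subgroup.coe_mul, Subgroup.coe_mul, Subgroup.coe_inv, hx]
    exact diagonalUnit_mul_upper3_mul_inv u α (Units.mk0 e he) γ hαγ hβ x z
  refine ⟨cellZ u hϖ hs m * (t₀ * n₁ * t₀⁻¹) * (cellZ u hϖ hs m)⁻¹,
    conj_cellZ_mem_upperUnipotent u hϖ hs m hn₂, m, t₀ * κ₁⁻¹,
    Subgroup.mul_mem _ ht₀K (Subgroup.inv_mem _ hκ₁), ?_⟩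
  rw [← mul_inv_eq_iff_eq_mul.2 hgκ.symm]
  group

end Main

/-! ## The Macdonald–Satake identification, unconditionally -/

section Unconditional

variable {R E : Type*} [CommRing R] [IsDomain R] [IsDiscreteValuationRing R] [Field E] [StarRing E]
  [Algebra R E] [IsFractionRing R E] [Finite (IsLocalRing.ResidueField R)]
  (hstar : ∀ x : E, IsLocalization.IsInteger R x → IsLocalization.IsInteger R (star x))
  (u : E) (hsu : star u = u) (hu0 : u ≠ 0) (hu : IsLocalization.IsInteger R u)
  (hu' : IsLocalization.IsInteger R u⁻¹) {ϖ : R} (hϖ : Irreducible ϖ)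
  (hs : star (algebraMap R E ϖ) = algebraMap R E ϖ) (k : Type*) [Field k] [CharZero k]
  [Finite (MulAction.orbit (hyperspecialSubgroup R (J3 u)) ((cellU hϖ hs u 1 : formUnitaryGroup (J3 u)) :
    formUnitaryGroup (J3 u) ⧸ hyperspecialSubgroup R (J3 u)))]

include hstar hsu hu0 hu hu' in
/-- **THE MACDONALD–SATAKE IDENTIFICATION, UNCONDITIONALLY**: for the unramified principal series `I(χ_α)`
(`c = α q^{−2}`, file 216) at an inert place (`htr`, `hnt`: the trace lift and the non-triviality of the
residue involution), the spherical vector `f₀` (right-`K`-invariant, `f₀(1) = 1`) satisfies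
`T₁ f₀ = (q² (α + α⁻¹) + (q − 1)) f₀` — its Hecke eigenvalue is the Satake transform `S(T₁)` of file 213 at `α`. -/
theorem heckeSMul_cellU_one_eq_smul_param' (htr : ∃ e : R, algebraMap R E e + star (algebraMap R E e) = 1)
    (hnt : ∃ t : IsLocalRing.ResidueField R, residueStar hstar hϖ hs t ≠ t)
    {α : k} (hα : α ≠ 0) {f₀ : formUnitaryGroup (J3 u) → k}
    (hf₀ : IsInduced u hϖ hs k (α * ((Nat.card (traceZero R E) : k) ^ 2)⁻¹) f₀)
    (hf₀K : f₀ ∈ LevelPositivity.invariants (rightRegular k) (hyperspecialSubgroup R (J3 u))) (h1 : f₀ 1 = 1) :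
    heckeSMul (rightRegular k) (doubleCosetOp k (hyperspecialSubgroup R (J3 u)) (cellU hϖ hs u 1)) ⟨f₀, hf₀K⟩ =
      ((Nat.card (traceZero R E) : k) ^ 2 * (α + α⁻¹) + ((Nat.card (traceZero R E) : k) - 1)) • ⟨f₀, hf₀K⟩ :=
  heckeSMul_cellU_one_eq_smul_param hstar u hsu hu0 hu hu' hϖ hs k
    (exists_mem_mul_cellZ_mul hstar u hsu hu0 hu hu' hϖ hs) htr hnt hα hf₀ hf₀K h1

end Unconditional

end Summit.Ventures.HodgeRepro2.T5InertIwasawa
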